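import Summits.QuantumFields.BalabanUV.T4Continuum.Support.TorusBlockRefinementCard

/-!
# T⁴ programme (cell `pub-balaban`, sub-cell `t4`) — THE BLOCK REFINEMENT IS THE ADJOINT OF pv22's BLOCK MAP AND IS `L^d`-TO-ONE:
# `S.image tcoarse ⊆ Z ↔ S ⊆ trefine Z`; pv22's closure `Z ↦ Z′` (`tclosure`, S44's nesting) against S43's refined footprint
# (`tclosure S ⊆ Z ↔ tcollar S ⊆ trefine Z` — every fine domain lies, WITH ITS COLLAR, in the refined footprint of its closure);
# `#(trefine Z) = L^d · #Z`

Crew seat `b2b-balaban-t4-ne1p-formalise-leaf-05` (LEAF PROVER 05, generation 12), NE1′ formalisation crew; crew row **S54** ∕ DAG N29zzzx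
(INTENT `CLAIMS.log` 2026-08-20 l.22192, BOOKED typer gen 8 R-T138 l.22332, cross-read X200); sibling of S43 PART 1 `Support/TorusBlockRefinement`
(p233746) and S47 `Support/TorusBlockRefinementCard` (p235667) — NEW theorems only, their bytes untouched.  OUR lattice arithmetic on pv22's
periodic index model, Summits-side (LEAN PLACEMENT RULE); imports S47
ONLY (S43.1, pv22's cite-tagged `TreeLengthTorus` ∕ `TreeLengthTorusTransfer` and b16's window lemmas in its cone); THEOREMS ONLY
(0 `def`, 0 `def … : Prop`, 0 cite); nothing of S43 ∕ S47 ∕ pv22 is restated — their declarations are used BY NAME.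

WHY THIS FILE.  The crew now carries TWO nestings of pv22's tori `tsys d (L·N′)` (fine, scale k) and `tsys d N′` (coarse, scale k+1):
pv22's BLOCK MAP `tcoarse L N′` with the CLOSURE `tclosure L N′ Z₀ = (tcollar Z₀).image (tcoarse L N′)` (print's `Z₀ ↦ Z′₀`, «the smallest
localization domain from 𝐃_{k+1} containing Z̃₀», [Balaban1988RGII] p. 13 ∕ p. 19 — the direction of the owner's N0v∕N0w and the crew's
S44 ∕ S51 ∕ W59), and S43's REFINEMENT `trefine L N′ Z = {a | tcoarse a ∈ Z}` (the scale-`k` FOOTPRINT of a coarse polymer — the direction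
of the owner's N0u ∕ N0y `foot` and the crew's S43.2 ∕ S48).  This file records, in kernel, how the two fit together:
* §1 **`image_tcoarse_subset_iff`** — the refinement is the PREIMAGE of the block map, i.e. its right adjoint on families of cubes:
  `S.image (tcoarse L N′) ⊆ Z ↔ S ⊆ trefine L N′ Z`; with the unit `subset_trefine_image` (`S ⊆ trefine (S.image tcoarse)`), the counit
  = S43.1's `image_tcoarse_trefine` (equality), monotonicity and the lattice identities `trefine_union` ∕ `trefine_inter` ∕ `trefine_sdiff`
  ∕ `disjoint_trefine` (a preimage preserves them all).
* §2 **`tclosure_subset_iff`** — pv22's closure against the refinement: `tclosure L N′ S ⊆ Z ↔ tcollar S ⊆ trefine L N′ Z` (the closure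
  of `S` fits in the coarse family `Z` iff `S` TOGETHER WITH ITS COLLAR `S̃ = tcollar S` fits in the refined footprint of `Z`); hence
  **`tcollar_subset_trefine_tclosure`** ∕ **`subset_trefine_tclosure`** (every fine family — in particular every component `Z₀` of N0w's
  third∕fourth resummation step — lies, with its collar, inside the refined footprint `trefine (tclosure Z₀)` of its closure `Z′₀`: the
  geometric sentence that lets a closure-indexed component carry footprint-indexed inner labels, S44∕S51 ↔ S48∕S43.2), the Dom form
  **`val_subset_trefineDom_tclosureDom`** (`Z₀.1 ⊆ (trefineDom L N′ (tclosureDom L N′ Z₀)).1`), and in the other order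
  **`subset_tclosure_trefine`** (`Z ⊆ tclosure (trefine Z)` — the closure of a refined footprint contains the polymer; it is in general
  LARGER, by the collar's neighbouring blocks).
* §3 **`card_trefine`** — the refinement is `L^d`-to-one: `#(trefine L N′ Z) = L^d · #Z` for EVERY family `Z` (fibrewise over the block
  map, `Finset.card_eq_sum_card_fiberwise`, each fibre = `trefine {b}` with S47's `card_trefine_singleton`; S44 §2 carries the fibre
  inequality `≤ L^d`, S47 the one-block equality); Dom form `card_trefineDom`; decided instance `#(trefine 3 N′ Z) = 81 · #Z` on the
  four-torus (the volume bookkeeping a refined footprint brings into N0u∕N0y's `#(Z₀ ∖ ∪fam) ≤ 2·#P` and the anchor counts).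
HONEST FRAMING.  Elementary finite-set ∕ lattice arithmetic on pv22's periodic index model; no END of the owner's is fired here (supplier
lemmas for the junction of the two nestings); no statement of the audited manuscripts is asserted (print's `Z′`, `Z̃`, `L` are TYPE∕CONTEXT
through pv22's cite-tagged modules; WHICH pair of nested tori is Bałaban's `(𝐃_{k+1}, 𝐃_k)` stays pv22's READING, DIVERGENCE D-pv22.3);
[folklore] tags only; no placeholders.  Nothing of NE1′'s wall moves (wall WORDING v1.8 of record, T4-DAG v48 — words, not kind); NE1′ ⇐
the named binders — NOT printed, NOT proved; spine PROVED 0∕9; count 9 unchanged.  Rung (B)+1 on ONE finite four-torus — NOT infinite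
volume, NOT a mass gap, NOT OS on ℝ⁴, NOT Clay.  HONEST DEPENDENCY: continuum YM on T⁴ ⇐ BetaPertH ∧ nine spine estimates (0/9 proved);
BetaPertH ⇐ (D1) ∧ (D4) ∧ CAP+tail; G-an2-4 gates asym, D1 and NE2/3/4.
-/

namespace Summit.QuantumFields.BalabanUV.T4Continuum.TorusBlockRefinementClosure

open Literature.MathematicalPhysics.QuantumFieldTheory.Balaban1983to89.TreeLengthTorus (TPt TDom)
open Literature.MathematicalPhysics.QuantumFieldTheory.Balaban1983to89.TreeLengthTorusTransfer (tcoarse tcollar tclosure tclosureDom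
  subset_tcollar)
open Summit.QuantumFields.BalabanUV.T4Continuum.TorusBlockRefinement (trefine trefineDom mem_trefine image_tcoarse_trefine)
open Summit.QuantumFields.BalabanUV.T4Continuum.TorusBlockRefinementCard (card_trefine_singleton)

variable {d : ℕ} {L N' : ℕ} [NeZero L] [NeZero N']

/-! ## §1 The refinement is the preimage of the block map: the adjunction and the lattice identities -/

/-- **ADJUNCTION** [folklore]: a family `S` of fine cubes maps into the coarse family `Z` under the block map iff `S` lies in the
refinement of `Z` — `trefine L N′` is the preimage ∕ right adjoint of `Finset.image (tcoarse L N′)`. -/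
theorem image_tcoarse_subset_iff {S : Finset (TPt d (L * N'))} {Z : Finset (TPt d N')} :
    S.image (tcoarse L N') ⊆ Z ↔ S ⊆ trefine L N' Z := by
  rw [Finset.image_subset_iff]
  exact forall₂_congr fun a _ => mem_trefine.symm

/-- Unit of the adjunction [folklore]: every fine family lies in the refinement of the family of its blocks. -/
theorem subset_trefine_image (S : Finset (TPt d (L * N'))) : S ⊆ trefine L N' (S.image (tcoarse L N')) :=
  image_tcoarse_subset_iff.1 (Finset.Subset.refl _)

/-- The refinement is monotone. [folklore] -/
theorem trefine_mono {Z Z' : Finset (TPt d N')} (h : Z ⊆ Z') : trefine L N' Z ⊆ trefine L N' Z' :=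
  fun _ ha => mem_trefine.2 (h (mem_trefine.1 ha))

/-- The refinement is order-reflecting (the block map is onto: S43.1's `image_tcoarse_trefine`). [folklore] -/
theorem trefine_subset_trefine_iff {Z Z' : Finset (TPt d N')} : trefine L N' Z ⊆ trefine L N' Z' ↔ Z ⊆ Z' := by
  refine ⟨fun h => ?_, trefine_mono⟩
  rw [← image_tcoarse_trefine (L := L) Z]
  exact image_tcoarse_subset_iff.2 h

/-- The refinement of a union is the union of the refinements. [folklore] -/
theorem trefine_union (Z Z' : Finset (TPt d N')) : trefine L N' (Z ∪ Z') = trefine L N' Z ∪ trefine L N' Z' := by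
  ext a; simp only [mem_trefine, Finset.mem_union]

/-- The refinement of an intersection is the intersection of the refinements. [folklore] -/
theorem trefine_inter (Z Z' : Finset (TPt d N')) : trefine L N' (Z ∩ Z') = trefine L N' Z ∩ trefine L N' Z' := by
  ext a; simp only [mem_trefine, Finset.mem_inter]

/-- The refinement of a difference is the difference of the refinements. [folklore] -/
theorem trefine_sdiff (Z Z' : Finset (TPt d N')) : trefine L N' (Z \ Z') = trefine L N' Z \ trefine L N' Z' := by
  ext a; simp only [mem_trefine, Finset.mem_sdiff]

/-- The refinement of the empty family is empty. [folklore] -/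
@[simp] theorem trefine_empty : trefine L N' (∅ : Finset (TPt d N')) = ∅ := by
  ext a; simp only [mem_trefine, Finset.notMem_empty]

/-- Disjoint families have disjoint refinements. [folklore] -/
theorem disjoint_trefine {Z Z' : Finset (TPt d N')} (h : Disjoint Z Z') : Disjoint (trefine L N' Z) (trefine L N' Z') := by
  rw [Finset.disjoint_iff_inter_eq_empty] at h ⊢
  rw [← trefine_inter, h, trefine_empty]

/-! ## §2 pv22's closure `Z ↦ Z′` against the refined footprint -/

/-- **CLOSURE VERSUS REFINEMENT** [folklore]: the closure `Z′ = tclosure L N′ S` (the blocks met by the collar `S̃ = tcollar S`) fits in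
the coarse family `Z` iff the collar of `S` fits in the refined footprint of `Z`. -/
theorem tclosure_subset_iff {S : Finset (TPt d (L * N'))} {Z : Finset (TPt d N')} :
    tclosure L N' S ⊆ Z ↔ tcollar S ⊆ trefine L N' Z :=
  image_tcoarse_subset_iff

/-- Every fine family lies WITH ITS COLLAR in the refined footprint of its closure. [folklore] -/
theorem tcollar_subset_trefine_tclosure (S : Finset (TPt d (L * N'))) : tcollar S ⊆ trefine L N' (tclosure L N' S) :=
  tclosure_subset_iff.1 (Finset.Subset.refl _)

/-- **EVERY FINE FAMILY LIES IN THE REFINED FOOTPRINT OF ITS CLOSURE** [folklore]: `S ⊆ trefine L N′ (tclosure L N′ S)` — a component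
`Z₀` of the fine torus (closure-indexed, N0w ∕ S44's reading) sits inside the scale-`k` footprint of `Z′₀` (footprint-indexed, N0u ∕ N0y ∕
S43's reading). -/
theorem subset_trefine_tclosure (S : Finset (TPt d (L * N'))) : S ⊆ trefine L N' (tclosure L N' S) :=
  (subset_tcollar S).trans (tcollar_subset_trefine_tclosure S)

/-- If the closure of `S` lies in `Z`, then `S` lies in the refined footprint of `Z`. [folklore] -/
theorem subset_trefine_of_tclosure_subset {S : Finset (TPt d (L * N'))} {Z : Finset (TPt d N')} (h : tclosure L N' S ⊆ Z) :
    S ⊆ trefine L N' Z :=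
  (subset_trefine_tclosure S).trans (trefine_mono h)

/-- Dom form [folklore]: a torus localization domain of the fine torus lies in the refinement (S43.1's `trefineDom`) of its closure
(pv22's `tclosureDom`). -/
theorem val_subset_trefineDom_tclosureDom (Z₀ : TDom d (L * N')) : Z₀.1 ⊆ (trefineDom L N' (tclosureDom L N' Z₀)).1 :=
  subset_trefine_tclosure Z₀.1

/-- In the other order [folklore]: a coarse family lies in the closure of its refined footprint (which is in general LARGER — the
collar of the footprint meets the neighbouring blocks). -/
theorem subset_tclosure_trefine (Z : Finset (TPt d N')) : Z ⊆ tclosure L N' (trefine L N' Z) := by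
  intro b hb
  rw [← image_tcoarse_trefine (L := L) Z] at hb
  exact Finset.image_subset_image (subset_tcollar _) hb

/-! ## §3 The refinement is `L^d`-to-one -/

/-- The fibre of the block map over a block `b` inside a refined family is the refinement of `{b}`. [folklore] -/
theorem filter_trefine_tcoarse_eq {Z : Finset (TPt d N')} {b : TPt d N'} (hb : b ∈ Z) :
    (trefine L N' Z).filter (fun a => tcoarse L N' a = b) = trefine L N' {b} := by
  ext a
  simp only [Finset.mem_filter, mem_trefine, Finset.mem_singleton]
  exact ⟨fun h => h.2, fun h => ⟨h ▸ hb, h⟩⟩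

/-- **THE REFINEMENT IS `L^d`-TO-ONE** [folklore]: `#(trefine L N′ Z) = L^d · #Z` for every family `Z` of blocks (fibrewise over the
block map; each fibre is one refined block, S47's `card_trefine_singleton`). -/
theorem card_trefine (Z : Finset (TPt d N')) : (trefine L N' Z).card = L ^ d * Z.card := by
  classical
  rw [Finset.card_eq_sum_card_fiberwise (f := tcoarse L N') (t := Z) fun a ha => mem_trefine.1 (Finset.mem_coe.1 ha)]
  rw [Finset.sum_congr rfl fun b hb => by rw [filter_trefine_tcoarse_eq hb, card_trefine_singleton], Finset.sum_const, smul_eq_mul,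
    mul_comm]

/-- Dom form [folklore]: the refined footprint of a torus localization domain has `L^d` times as many cubes. -/
theorem card_trefineDom (Z : TDom d N') : (trefineDom L N' Z).1.card = L ^ d * Z.1.card :=
  card_trefine Z.1

/-- The refinement at least preserves the number of cubes (`L ≥ 1`). [folklore] -/
theorem card_le_card_trefine (Z : Finset (TPt d N')) : Z.card ≤ (trefine L N' Z).card := by
  rw [card_trefine]
  exact Nat.le_mul_of_pos_left _ (pow_pos (Nat.pos_of_ne_zero (NeZero.ne L)) d)

/-- Decided instance on the four-torus at `L = 3` [decided toy]: a refined footprint has `81` fine cubes per block. -/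
example (Z : Finset (TPt 4 N')) : (trefine 3 N' Z).card = 81 * Z.card := by
  rw [card_trefine]; norm_num

end Summit.QuantumFields.BalabanUV.T4Continuum.TorusBlockRefinementClosure
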